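import Mathlib
import HarnessLib.Audit
import Summits.PneNP.PneNP.Theorems.PstarSlackTwoTools

/-!
# No centre at slack two with a dirty chord (ROUND-24, O1; all sharing patterns; memo g25 §49)

FRONTIER range-avoidance ladder, rung F-N3, ROUND 24 (cell `pnp-ideate`, prover-2 memo `g25/O1-XORSPLIT-g25.md` §49; typed targets
`PstarCoreBoundTargets.TerminalFive` / `TerminalPeelable` (p646951); restricted-model proof complexity — nothing here bears on `P` versus `NP`).

Third layer of the defect counting (`PstarMaxSharingCentre` slack `0`, `PstarSlackOneCentre` slack `1`): **`no_centre_at_slack_two_dirty`** — inside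
the core-bound induction, an X-connected terminal core with `2·#bdry K = 3·#K + 2` having at least one DIRTY chord carries no centre (every `s`).
* Two dirty chords: their inside gates `g, g'` make `K + g + g'` boundary-tight (one gate reading both privates already breaks expansion of `K + g`),
  so every clean chord has a degree-two endpoint and `#C = #K − #N − 2 ≤ u − 3 ≤ #N − 1` contradicts `2·#N + 2 ≤ #K`.
* One dirty chord with gate `g`: if `K + g` is tight, as before; else `K + g` has slack one, two fat clean chords share a degree-three endpoint
  (`exists_shared_deg_three` in `K + g`), four fat chords are impossible (`false_of_four_fat`), and exactly three force — through the refined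
  degree-two injection — all their endpoints onto the three vertices of the centre: six members on three vertices (`card_le_three_of_xpairs_subset`).
The remaining slack-two case (no dirty chord) needs the triple-deletion combinatorics and is not treated here.
-/

set_option linter.dupNamespace false -- `Summit.PneNP.PneNP.…`: summit = sub-problem name (D-0017 single-conjunct layout)

open Finset Literature.Computability.Complexity
open Summit.PneNP.PneNP.Theorems.PstarTyped (Typed)
open Summit.PneNP.PneNP.Theorems.PstarSALevel (varSet bdry BoundaryExpanding SimpleOverlap)
open Summit.PneNP.PneNP.Theorems.PstarSAClosure (degIn mem_bdry_iff)
open Summit.PneNP.PneNP.Theorems.PstarXCore (xpair mem_xpair xverts)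
open Summit.PneNP.PneNP.Theorems.PstarCentreFree (vars_mem_varSet)
open Summit.PneNP.PneNP.Theorems.PstarCoreBound (XorClosed)
open Summit.PneNP.PneNP.Theorems.PstarChordRepair (IsChord)
open Summit.PneNP.PneNP.Theorems.PstarCoreBoundTargets (Terminal nonchords mem_nonchords)
open Summit.PneNP.PneNP.Theorems.PstarSharingBound (sharedSlots card_bdry_add_card_sharedSlots_le)
open Summit.PneNP.PneNP.Theorems.PstarChordBridgeTools (xpdeg)
open Summit.PneNP.PneNP.Theorems.PstarChordBridgeExchange (mem_xverts_iff)
open Summit.PneNP.PneNP.Theorems.PstarNorUnitCoverTools (three_le_card_of_leafless)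
open Summit.PneNP.PneNP.Theorems.PstarChordReadOutside (OutsideGated)
open Summit.PneNP.PneNP.Theorems.PstarChordReadTwoCleanCount (card_dirty_le_slack)
open Summit.PneNP.PneNP.Theorems.PstarCleanChordCount (card_nonchords_le_card_sharedSlots)
open Summit.PneNP.PneNP.Theorems.PstarNoFreeVertex (covered_of_terminal mem_varSet_of_mem_xpair)
open Summit.PneNP.PneNP.Theorems.PstarSkeletonSpan (XConnected skel mem_skel card_xverts_le_card_skel xverts_mono)
open Summit.PneNP.PneNP.Theorems.PstarMaxSharingCentre (card_bdry_erase_le)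
open Summit.PneNP.PneNP.Theorems.PstarSlackTools (three_le_card_xverts_of_leafless card_deg2_chords_add_le degIn_insert card_bdry_insert_le
  two_le_degIn exists_shared_deg_three)
open Summit.PneNP.PneNP.Theorems.PstarSlackTwoTools (exists_inside_gate not_mem_varSet_gate_of_clean isChord_insert_of_clean
  card_bdry_insert_le_two card_deg2_chords_le_filter false_of_four_fat card_le_three_of_xpairs_subset)

namespace Summit.PneNP.PneNP.Theorems.PstarSlackTwoDirty

variable {n m : ℕ} {I : LocalMap 4 n m} {r : ℕ} {y : Fin m → Bool} {K : Finset (Fin m)} {w₁ w₂ : Finset (Fin n) × Finset (Fin m) × Bool}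

/-- **NO CENTRE AT SLACK TWO WITH A DIRTY CHORD** (all sharing patterns, all core sizes; inside the core-bound induction).  An X-connected terminal
core `K` of a pure typed `(r,3/2)`-expanding instance with simple overlaps with `2·#bdry K = 3·#K + 2` and at least one chord that is not
outside-gated has no non-empty leafless set of non-chords. -/
theorem no_centre_at_slack_two_dirty (hI : I.IsPure xorAndPred) (hT : Typed I) (hS : SimpleOverlap I) (hB : BoundaryExpanding r I)
    (ht : Terminal I r y K w₁ w₂)
    (hIH : ∀ c ∈ K, ∀ K₀ ⊆ K.erase c, ∀ d d' : Finset (Fin n) × Finset (Fin m) × Bool, Terminal I r y K₀ d d' → K₀.card ≤ 5)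
    (hconn : XConnected I K) (hslack : 2 * (bdry I K).card = 3 * K.card + 2)
    (hdirty : ∃ d ∈ K, IsChord I K d ∧ ¬ OutsideGated I K (w₁.2.1 ∪ w₂.2.1) d) :
    ¬ ∃ S ⊆ K, S.Nonempty ∧ (∀ w ∈ xverts I S, 2 ≤ xpdeg I S w) ∧ ∀ f ∈ S, ¬ IsChord I K f := by
  classical
  rintro ⟨S, hSK, hSne, hSL, hSnc⟩
  have hX : XorClosed I K := ht.2.1
  have hKr : K.card < r := ht.2.2.1
  have hd : Disjoint K (w₁.2.1 ∪ w₂.2.1) := disjoint_union_right.2 ⟨ht.2.2.2.1, ht.2.2.2.2.1⟩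
  have hr : (K ∪ (w₁.2.1 ∪ w₂.2.1)).card ≤ r := by rw [← union_assoc]; exact ht.2.2.2.2.2.1
  set M := w₁.2.1 ∪ w₂.2.1 with hM
  -- bookkeeping
  have hbs := card_bdry_add_card_sharedSlots_le I K hX
  have hN := card_nonchords_le_card_sharedSlots I K
  have h2N : 2 * (nonchords I K).card + 2 ≤ K.card := by omega
  set 𝒟 := K.filter fun c => IsChord I K c ∧ ¬ OutsideGated I K M c with h𝒟
  have h𝒟2 : 𝒟.card ≤ 2 :=
    card_dirty_le_slack hB ht (t := 2) (by omega) (filter_subset _ K) (fun c hc => (mem_filter.1 hc).2.1) (fun c hc => (mem_filter.1 hc).2.2)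
  have hskel : skel I K M ⊆ nonchords I K ∪ 𝒟 := by
    intro f hf
    obtain ⟨hfK, hnot⟩ := (mem_skel I).1 hf
    by_cases hch : IsChord I K f
    · exact mem_union_right _ (mem_filter.2 ⟨hfK, hch, fun hO => hnot ⟨hch, hO⟩⟩)
    · exact mem_union_left _ ((mem_nonchords I).2 ⟨hfK, hch⟩)
  have hu : (xverts I K).card ≤ (nonchords I K).card + 𝒟.card :=
    ((card_xverts_le_card_skel hI hT hS hB ht hIH hconn ⟨S, hSK, hSne, hSL, hSnc⟩).trans (card_le_card hskel)).trans
      (card_union_le _ _)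
  set C := K.filter fun c => IsChord I K c ∧ OutsideGated I K M c with hC
  have hsplit : C.card + 𝒟.card + (nonchords I K).card = K.card := by
    have h1 := card_filter_add_card_filter_not (s := K) (fun c => IsChord I K c)
    have e : (K.filter fun c => ¬ IsChord I K c) = nonchords I K := by ext f; rw [mem_filter, mem_nonchords]
    rw [e] at h1
    have h2 := card_filter_add_card_filter_not (s := K.filter fun c => IsChord I K c) (fun c => OutsideGated I K M c)
    rw [filter_filter, filter_filter] at h2
    rw [hC, h𝒟]
    omega
  set C₂ := C.filter fun c => ∃ w ∈ xpair I c, degIn I K w = 2 with hC₂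
  set C'' := C.filter fun c => ¬ ∃ w ∈ xpair I c, degIn I K w = 2 with hC''
  have hCsplit : C₂.card + C''.card = C.card := card_filter_add_card_filter_not _
  have hcov := covered_of_terminal hI hT hS hB ht
  have hC₂mem : ∀ c ∈ C₂, c ∈ K ∧ IsChord I K c ∧ OutsideGated I K M c ∧ ∃ w ∈ xpair I c, degIn I K w = 2 := fun c hc => by
    obtain ⟨hcC, hw⟩ := mem_filter.1 hc
    obtain ⟨hcK, hch, hO⟩ := mem_filter.1 hcC
    exact ⟨hcK, hch, hO, hw⟩
  have hC₂ : C₂.card + (xverts I S).card ≤ (xverts I K).card := card_deg2_chords_add_le I hI hcov hC₂mem hSK hSL hSnc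
  have h3 := three_le_card_xverts_of_leafless I hI hS hSne hSL
  have hdeg2 : ∀ c ∈ K, ∀ w ∈ xpair I c, 2 ≤ degIn I K w := by
    intro c hc w hw
    have h1 : degIn I K w ≠ 1 := by
      intro h1
      have hb := (mem_bdry_iff I K w).2 h1
      rcases (mem_xpair I).1 hw with h | h
      · exact hX c hc 0 (by decide) (h ▸ hb)
      · exact hX c hc 1 (by decide) (h ▸ hb)
    have h0 : 0 < degIn I K w := by
      unfold PstarSAClosure.degIn; exact card_pos.2 ⟨c, mem_filter.2 ⟨hc, mem_varSet_of_mem_xpair hw⟩⟩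
    omega
  -- the dirty chord `d` and its inside gate `g`
  obtain ⟨d, hdK, hdch, hdO⟩ := hdirty
  have hd𝒟 : d ∈ 𝒟 := mem_filter.2 ⟨hdK, hdch, hdO⟩
  obtain ⟨g, hgM, hgK, hg2, hg3, v, hv, hvg, hvb⟩ := exists_inside_gate I hd hdK hdch hdO
  set F := insert g K with hF
  have hFsub : F ⊆ K ∪ M := by rw [hF]; exact insert_subset (mem_union_right _ hgM) subset_union_left
  have hFr : F.card ≤ r := (card_le_card hFsub).trans hr
  have hFcard : F.card = K.card + 1 := by rw [hF, card_insert_of_notMem hgK]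
  have hbF : (bdry I F).card + 1 ≤ (bdry I K).card + 2 := card_bdry_insert_le I hgK hg2 hg3 hvb hvg
  have hexpF := hB F hFr
  have chordF : ∀ c ∈ C, IsChord I F c := fun c hc => by
    obtain ⟨-, hch, hO⟩ := mem_filter.1 hc
    exact isChord_insert_of_clean I hT hgM hgK hg2 hg3 hch hO
  -- in a boundary-tight family containing `K` (and extra members reading no AND slot of the clean chords), every clean chord is in `C₂`
  have tightC₂ : ∀ (E : Finset (Fin m)), K ⊆ E → E.card ≤ r → 2 * (bdry I E).card ≤ 3 * E.card → (∀ c ∈ C, IsChord I E c) →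
      (∀ w, degIn I K w ≤ degIn I E w) → ∀ c ∈ C, c ∈ C₂ := by
    intro E hKE hEr htight hchE hmono c hc
    obtain ⟨hcK, -, -⟩ := mem_filter.1 hc
    have hcE : c ∈ E := hKE hcK
    have h1 := card_bdry_erase_le I hI hcE (hchE c hc)
    have hexp := hB (E.erase c) ((card_le_card (erase_subset c E)).trans hEr)
    have hEcard : (E.erase c).card + 1 = E.card := card_erase_add_one hcE
    have hpos : 0 < ((xpair I c).filter fun w => degIn I E w = 2).card := by omega
    obtain ⟨w, hw⟩ := card_pos.1 hpos
    obtain ⟨hwc, hdw⟩ := mem_filter.1 hw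
    refine mem_filter.2 ⟨hc, w, hwc, ?_⟩
    have := hdeg2 c hcK w hwc
    have := hmono w
    omega
  have hmonoF : ∀ w, degIn I K w ≤ degIn I F w := fun w => by rw [hF, degIn_insert I hgK]; omega
  by_cases hD2 : 𝒟.card = 2
  · -- TWO DIRTY CHORDS
    obtain ⟨d', hd'⟩ : (𝒟.erase d).Nonempty := card_pos.1 (by rw [card_erase_of_mem hd𝒟]; omega)
    obtain ⟨hd'd, hd'𝒟⟩ := mem_erase.1 hd'
    obtain ⟨hd'K, hd'ch, hd'O⟩ := mem_filter.1 hd'𝒟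
    obtain ⟨g', hg'M, hg'K, hg'2, hg'3, v', hv', hv'g', hv'b⟩ := exists_inside_gate I hd hd'K hd'ch hd'O
    have hvv' : v ≠ v' := by
      intro hvv'
      have hvd : v ∈ varSet I d := by rcases hv with rfl | rfl <;> exact vars_mem_varSet I d _
      have hvd' : v ∈ varSet I d' := by rw [hvv']; rcases hv' with rfl | rfl <;> exact vars_mem_varSet I d' _
      have h2 := two_le_degIn I hdK hd'K (Ne.symm hd'd) hvd hvd'
      have h1 := (mem_bdry_iff I K v).1 hvb
      omega
    by_cases hsame : v' ∈ varSet I g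
    · -- `g` reads both privates: `K + g` breaks expansion
      have h := card_bdry_insert_le_two I hgK hg2 hg3 hvv' hvb hvg hv'b hsame
      rw [← hF] at h
      omega
    · -- `g' ≠ g`: the family `K + g + g'` is tight
      have hg'g : g' ≠ g := fun h => hsame (h ▸ hv'g')
      have hg'F : g' ∉ F := by rw [hF, mem_insert]; push Not; exact ⟨hg'g, hg'K⟩
      have hv'F : v' ∈ bdry I F := by
        rw [mem_bdry_iff, hF, degIn_insert I hgK, if_neg hsame, (mem_bdry_iff I K v').1 hv'b]
      set F₂ := insert g' F with hF₂
      have hKF : K ⊆ F := by rw [hF]; exact subset_insert g K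
      have hg'2F : ∃ j ∈ F, I.vars g' 2 ∈ varSet I j := by obtain ⟨j, hj, h⟩ := hg'2; exact ⟨j, hKF hj, h⟩
      have hg'3F : ∃ j ∈ F, I.vars g' 3 ∈ varSet I j := by obtain ⟨j, hj, h⟩ := hg'3; exact ⟨j, hKF hj, h⟩
      have hbF₂ : (bdry I F₂).card + 1 ≤ (bdry I F).card + 2 := card_bdry_insert_le I hg'F hg'2F hg'3F hv'F hv'g'
      have hF₂sub : F₂ ⊆ K ∪ M := by rw [hF₂]; exact insert_subset (mem_union_right _ hg'M) hFsub
      have hF₂r : F₂.card ≤ r := (card_le_card hF₂sub).trans hr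
      have hF₂card : F₂.card = K.card + 2 := by rw [hF₂, card_insert_of_notMem hg'F, hFcard]
      have hexpF₂ := hB F₂ hF₂r
      have chordF₂ : ∀ c ∈ C, IsChord I F₂ c := by
        intro c hc
        obtain ⟨-, hch, hO⟩ := mem_filter.1 hc
        have key : ∀ s : Fin 4, 2 ≤ s.val → I.vars c s ∈ bdry I K → I.vars c s ∈ bdry I F₂ := by
          intro s hs hb
          rw [mem_bdry_iff] at hb ⊢
          rw [hF₂, degIn_insert I hg'F, if_neg (not_mem_varSet_gate_of_clean I hT hg'M hg'2 hg'3 hO s hs), hF,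
            degIn_insert I hgK, if_neg (not_mem_varSet_gate_of_clean I hT hgM hg2 hg3 hO s hs), hb]
        exact ⟨key 2 (by decide) hch.1, key 3 (by decide) hch.2⟩
      have hmonoF₂ : ∀ w, degIn I K w ≤ degIn I F₂ w := fun w => by
        rw [hF₂, degIn_insert I hg'F, hF, degIn_insert I hgK]; omega
      have all : ∀ c ∈ C, c ∈ C₂ :=
        tightC₂ F₂ (hKF.trans (by rw [hF₂]; exact subset_insert g' F)) hF₂r (by omega) chordF₂ hmonoF₂
      have hC''0 : C''.card = 0 := card_eq_zero.2 (filter_eq_empty_iff.2 fun c hc h => h (mem_filter.1 (all c hc)).2)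
      omega
  · -- ONE DIRTY CHORD
    have hD1 : 𝒟.card = 1 := by
      have : 0 < 𝒟.card := card_pos.2 ⟨d, hd𝒟⟩
      omega
    by_cases htight : 2 * (bdry I F).card ≤ 3 * F.card
    · have all : ∀ c ∈ C, c ∈ C₂ := tightC₂ F (by rw [hF]; exact subset_insert g K) hFr htight chordF hmonoF
      have hC''0 : C''.card = 0 := card_eq_zero.2 (filter_eq_empty_iff.2 fun c hc h => h (mem_filter.1 (all c hc)).2)
      omega
    · -- `K + g` has slack one: fat clean chords pairwise share degree-three endpoints
      have hslackF : 2 * (bdry I F).card ≤ 3 * F.card + 1 := by omega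
      have pair : ∀ c ∈ C'', ∀ c' ∈ C'', c ≠ c' → ∃ w ∈ xpair I c, w ∈ xpair I c' ∧ degIn I K w = 3 := by
        intro c hc c' hc' hne
        obtain ⟨hcC, hno⟩ := mem_filter.1 hc
        obtain ⟨hc'C, hno'⟩ := mem_filter.1 hc'
        obtain ⟨hcK, -, -⟩ := mem_filter.1 hcC
        obtain ⟨hc'K, -, -⟩ := mem_filter.1 hc'C
        push Not at hno hno'
        have hcF : c ∈ F := by rw [hF]; exact mem_insert_of_mem hcK
        have hc'F : c' ∈ F := by rw [hF]; exact mem_insert_of_mem hc'K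
        have hnoF : ∀ w ∈ xpair I c, degIn I F w ≠ 2 := fun w hw h => by
          have := hno w hw; have := hdeg2 c hcK w hw; have := hmonoF w; omega
        have hnoF' : ∀ w ∈ xpair I c', degIn I F w ≠ 2 := fun w hw h => by
          have := hno' w hw; have := hdeg2 c' hc'K w hw; have := hmonoF w; omega
        obtain ⟨w, hwc, hwc', hdw⟩ := exists_shared_deg_three I hI hT hB hFr hslackF hcF hc'F hne (chordF c hcC) (chordF c' hc'C) hnoF hnoF'
        refine ⟨w, hwc, hwc', ?_⟩
        have := hno w hwc; have := hdeg2 c hcK w hwc; have := hmonoF w; omega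
      -- refined count: fat chords ≥ 3 + (vertices of degree ≠ 2 off the centre)
      set Y := (xverts I K \ xverts I S).filter fun v => ¬ degIn I K v = 2 with hY
      have hC₂f := card_deg2_chords_le_filter I hI hcov hC₂mem hSK hSL hSnc
      have hYsplit : ((xverts I K \ xverts I S).filter fun v => degIn I K v = 2).card + Y.card = (xverts I K \ xverts I S).card :=
        card_filter_add_card_filter_not _
      have hVS : (xverts I K \ xverts I S).card + (xverts I S).card = (xverts I K).card := card_sdiff_add_card_eq_card (xverts_mono I hSK)
      have hC''3 : 3 + Y.card ≤ C''.card := by omega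
      by_cases h4 : 4 ≤ C''.card
      · -- four fat chords: pigeonhole
        obtain ⟨c₁, hc₁⟩ : C''.Nonempty := card_pos.1 (by omega)
        obtain ⟨c₂, hc₂⟩ : (C''.erase c₁).Nonempty := card_pos.1 (by rw [card_erase_of_mem hc₁]; omega)
        obtain ⟨c₃, hc₃⟩ : ((C''.erase c₁).erase c₂).Nonempty := card_pos.1 (by
          rw [card_erase_of_mem hc₂, card_erase_of_mem hc₁]; omega)
        obtain ⟨c₄, hc₄⟩ : (((C''.erase c₁).erase c₂).erase c₃).Nonempty := card_pos.1 (by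
          rw [card_erase_of_mem hc₃, card_erase_of_mem hc₂, card_erase_of_mem hc₁]; omega)
        have h21 : c₂ ≠ c₁ := (mem_erase.1 hc₂).1
        have hc₂'' : c₂ ∈ C'' := mem_of_mem_erase hc₂
        have h32 : c₃ ≠ c₂ := (mem_erase.1 hc₃).1
        have h31 : c₃ ≠ c₁ := (mem_erase.1 (mem_of_mem_erase hc₃)).1
        have hc₃'' : c₃ ∈ C'' := mem_of_mem_erase (mem_of_mem_erase hc₃)
        have h43 : c₄ ≠ c₃ := (mem_erase.1 hc₄).1
        have h42 : c₄ ≠ c₂ := (mem_erase.1 (mem_of_mem_erase hc₄)).1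
        have h41 : c₄ ≠ c₁ := (mem_erase.1 (mem_of_mem_erase (mem_of_mem_erase hc₄))).1
        have hc₄'' : c₄ ∈ C'' := mem_of_mem_erase (mem_of_mem_erase (mem_of_mem_erase hc₄))
        have memC : ∀ c ∈ C'', c ∈ K ∧ (IsChord I K c ∧ OutsideGated I K M c) := fun c hc => by
          obtain ⟨hcC, -⟩ := mem_filter.1 hc
          obtain ⟨hcK, hch, hO⟩ := mem_filter.1 hcC
          exact ⟨hcK, hch, hO⟩
        exact false_of_four_fat I hcov (memC c₁ hc₁).1 (memC c₂ hc₂'').1 (memC c₃ hc₃'').1 (memC c₄ hc₄'').1 (memC c₁ hc₁).2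
          (memC c₂ hc₂'').2 (memC c₃ hc₃'').2 (memC c₄ hc₄'').2 h21 h31 h41 h32 h42 h43 (pair c₁ hc₁ c₂ hc₂'' h21.symm)
          (pair c₁ hc₁ c₃ hc₃'' h31.symm) (pair c₁ hc₁ c₄ hc₄'' h41.symm)
      · -- exactly three fat chords, everything tight: six members on the three vertices of the centre
        have hY0 : Y.card = 0 := by omega
        have hVS3 : (xverts I S).card = 3 := by omega
        have fatIn : ∀ c ∈ C'', xpair I c ⊆ xverts I S := by
          intro c hc a ha
          obtain ⟨hcC, hno⟩ := mem_filter.1 hc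
          obtain ⟨hcK, -, -⟩ := mem_filter.1 hcC
          push Not at hno
          by_contra haS
          have haY : a ∈ Y := mem_filter.2 ⟨mem_sdiff.2 ⟨(mem_xverts_iff I K a).2 ⟨c, hcK, ha⟩, haS⟩, hno a ha⟩
          rw [card_eq_zero] at hY0
          rw [hY0] at haY
          exact notMem_empty a haY
        have hT : ∀ j ∈ S ∪ C'', xpair I j ⊆ xverts I S := by
          intro j hj
          rcases mem_union.1 hj with hj | hj
          · exact fun a ha => (mem_xverts_iff I S a).2 ⟨j, hj, ha⟩
          · exact fatIn j hj
        have hle := card_le_three_of_xpairs_subset I hI hS hVS3 hT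
        have hdisj : Disjoint S C'' := by
          refine disjoint_left.2 fun f hfS hfC => hSnc f hfS ?_
          obtain ⟨hfC', -⟩ := mem_filter.1 hfC
          exact (mem_filter.1 hfC').2.1
        rw [card_union_of_disjoint hdisj] at hle
        have hS3 := three_le_card_of_leafless I hI hS hSne hSL
        omega

end Summit.PneNP.PneNP.Theorems.PstarSlackTwoDirty
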